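import Summits.Ventures.HodgeRepro2.T5SU11GaussLegendreWeights

/-!
# The Christoffel function `λ_n(x) = 1/K_n(x, x)` as an extremal value, and the Gauss–Legendre weights as minima

For the reproducing kernel `K_n(x, y) = Σ_{k ≤ n} ((2k + 1)/2) P_k(x) P_k(y)` (row 409) and any polynomial `p` of degree
`≤ n` with `p(x) = 1`, the reproducing property and the Cauchy–Schwarz inequality for interval integrals
(`integral_mul_sq_le`, proved by the discriminant of `λ ↦ ∫ (g − λ h)²`) give

  `1 = p(x)² = (∫ K_n(x, y) p(y) dy)² ≤ (∫ K_n(x, y)² dy)(∫ p²) = K_n(x, x) · ∫ p²`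

(`∫ K_n(x, y)² dy = K_n(x, x)` by reproducing `K_n(·, x)` itself, `integral_kernel_sq`), so

  **`∫_{−1}^{1} p(y)² dy ≥ 1/K_n(x, x)` for every `p` of degree `≤ n` with `p(x) = 1`**   (`integral_sq_ge_of_eval_eq_one`),

with EQUALITY for `p = K_n(·, x)/K_n(x, x)` (`integral_sq_extremal`): the CHRISTOFFEL FUNCTION
`λ_n(x) := 1/K_n(x, x)` is the minimum of `∫ p²` over the normalised polynomials of degree `≤ n`
(`christoffelFun`, `christoffelFun_eq_min`). At a node of the `(n+1)`-point Gauss–Legendre rule the weight is the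
Christoffel function (row 410), so

  **`w_i = min { ∫_{−1}^{1} p² : deg p ≤ n, p(x_i) = 1 }`**   (`weight_eq_christoffelFun`, `weight_le_integral_sq`),

the variational characterisation of the Gauss–Legendre weights. Nothing is claimed about (N).

Blind lane: Mathlib + the HodgeRepro2 prefix only; no sorry; axioms ⊆ {propext, Classical.choice,
Quot.sound}.
-/

namespace Summit.Ventures.HodgeRepro2.T5SU11ChristoffelFunction

open Polynomial intervalIntegral Finset Set
open T5SU11SphericalLegendreAll T5SU11JacobiPhaseLawEven T5SU11JacobiLegendreLeading T5SU11LegendreIdentities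
  T5SU11LegendreOrthogonal T5SU11LegendreOrthogonalLower T5SU11LegendreZeros T5SU11GaussLegendre
  T5SU11LegendreExpansion T5SU11GaussLegendreWeights

/-! ### Cauchy–Schwarz on `[−1, 1]` -/

/-- **Cauchy–Schwarz for continuous functions on `[−1, 1]`**: `(∫ g h)² ≤ (∫ g²)(∫ h²)`. -/
theorem integral_mul_sq_le {g h : ℝ → ℝ} (hg : Continuous g) (hh : Continuous h) :
    (∫ x in (-1 : ℝ)..1, g x * h x) ^ 2
      ≤ (∫ x in (-1 : ℝ)..1, g x ^ 2) * ∫ x in (-1 : ℝ)..1, h x ^ 2 := by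
  set A := ∫ x in (-1 : ℝ)..1, g x ^ 2 with hA
  set B := ∫ x in (-1 : ℝ)..1, g x * h x with hB
  set C := ∫ x in (-1 : ℝ)..1, h x ^ 2 with hC
  -- `0 ≤ ∫ (g − t h)² = A − 2tB + t²C` for every `t`
  have hquad : ∀ t : ℝ, 0 ≤ A - 2 * t * B + t ^ 2 * C := by
    intro t
    have h0 : 0 ≤ ∫ x in (-1 : ℝ)..1, (g x - t * h x) ^ 2 :=
      integral_nonneg (by norm_num) fun x _ => sq_nonneg _
    have e : ∀ x, (g x - t * h x) ^ 2 = g x ^ 2 - 2 * t * (g x * h x) + t ^ 2 * h x ^ 2 := fun x => by ring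
    simp_rw [e] at h0
    have i1 : IntervalIntegrable (fun x => g x ^ 2) MeasureTheory.volume (-1 : ℝ) 1 :=
      (hg.pow 2).intervalIntegrable _ _
    have i2 : IntervalIntegrable (fun x => 2 * t * (g x * h x)) MeasureTheory.volume (-1 : ℝ) 1 :=
      (continuous_const.mul (hg.mul hh)).intervalIntegrable _ _
    have i3 : IntervalIntegrable (fun x => t ^ 2 * h x ^ 2) MeasureTheory.volume (-1 : ℝ) 1 :=
      (continuous_const.mul (hh.pow 2)).intervalIntegrable _ _
    rw [integral_add (i1.sub i2) i3, integral_sub i1 i2, integral_const_mul, integral_const_mul] at h0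
    exact h0
  have hC0 : 0 ≤ C := integral_nonneg (by norm_num) fun x _ => sq_nonneg _
  rcases hC0.lt_or_eq with hCpos | hCzero
  · -- `t = B/C`
    have := hquad (B / C)
    have hC' : C ≠ 0 := hCpos.ne'
    have e : A - 2 * (B / C) * B + (B / C) ^ 2 * C = (A * C - B ^ 2) / C := by
      field_simp
      ring
    rw [e, le_div_iff₀ hCpos, zero_mul] at this
    linarith
  · -- `C = 0`: then `B = 0`
    rw [← hCzero]
    have hB0 : B = 0 := by
      by_contra hne
      have := hquad ((A + 1) / (2 * B))
      rw [← hCzero, mul_zero, add_zero] at this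
      have e : A - 2 * ((A + 1) / (2 * B)) * B = -1 := by
        field_simp
        ring
      rw [e] at this
      linarith
    rw [hB0]
    norm_num

/-! ### The reproducing kernel on itself -/

/-- **`∫_{−1}^{1} K_n(x, y)² dy = K_n(x, x)`** (reproducing `K_n(·, x)`, a polynomial of degree `≤ n`). -/
theorem integral_kernel_sq (n : ℕ) (x : ℝ) : ∫ y in (-1 : ℝ)..1, kernel n x y ^ 2 = kernel n x x := by
  have h := integral_kernel_mul_eq (natDegree_kernelPoly_le n x) x
  have hsymm : ∀ y, kernel n y x = kernel n x y := fun y => by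
    rw [kernel, kernel]
    exact Finset.sum_congr rfl fun k _ => by ring
  simp_rw [eval_kernelPoly, hsymm, ← sq] at h
  exact h

/-- `K_n(x, y) = K_n(y, x)`. -/
theorem kernel_symm (n : ℕ) (x y : ℝ) : kernel n x y = kernel n y x := by
  rw [kernel, kernel]
  exact Finset.sum_congr rfl fun k _ => by ring

/-- `y ↦ K_n(x, y)` is continuous. -/
theorem continuous_kernel (n : ℕ) (x : ℝ) : Continuous fun y => kernel n x y := by
  have : (fun y => kernel n x y) = fun y => (kernelPoly n x).eval y :=
    funext fun y => by rw [eval_kernelPoly, kernel_symm]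
  rw [this]
  exact (kernelPoly n x).continuous

/-! ### The extremal property -/

/-- **`∫ p² ≥ 1/K_n(x, x)`** for every polynomial `p` of degree `≤ n` with `p(x) = 1`. -/
theorem integral_sq_ge_of_eval_eq_one {n : ℕ} {p : ℝ[X]} (hp : p.natDegree ≤ n) {x : ℝ} (hx : p.eval x = 1) :
    1 / kernel n x x ≤ ∫ y in (-1 : ℝ)..1, p.eval y ^ 2 := by
  have hK := kernel_self_pos n x
  have hrep := integral_kernel_mul_eq hp x
  rw [hx] at hrep
  have hcs := integral_mul_sq_le (continuous_kernel n x) p.continuous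
  rw [hrep, integral_kernel_sq, one_pow] at hcs
  rw [div_le_iff₀ hK]
  linarith

/-- **Equality for `p = K_n(·, x)/K_n(x, x)`**: `∫ (K_n(y, x)/K_n(x, x))² dy = 1/K_n(x, x)`. -/
theorem integral_sq_extremal (n : ℕ) (x : ℝ) :
    ∫ y in (-1 : ℝ)..1, (C (kernel n x x)⁻¹ * kernelPoly n x).eval y ^ 2 = 1 / kernel n x x := by
  have hK := kernel_self_pos n x
  simp_rw [eval_mul, eval_C, eval_kernelPoly, mul_pow, kernel_symm n _ x]
  rw [integral_const_mul, integral_kernel_sq]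
  field_simp

/-- The extremal polynomial is normalised: `(K_n(·, x)/K_n(x, x))(x) = 1`, degree `≤ n`. -/
theorem extremal_eval (n : ℕ) (x : ℝ) :
    (C (kernel n x x)⁻¹ * kernelPoly n x).eval x = 1 ∧ (C (kernel n x x)⁻¹ * kernelPoly n x).natDegree ≤ n := by
  have hK := kernel_self_pos n x
  constructor
  · rw [eval_mul, eval_C, eval_kernelPoly, inv_mul_cancel₀ hK.ne']
  · exact (natDegree_C_mul_le _ _).trans (natDegree_kernelPoly_le n x)

/-- **The Christoffel function** `λ_n(x) = 1/K_n(x, x)`. -/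
noncomputable def christoffelFun (n : ℕ) (x : ℝ) : ℝ := 1 / kernel n x x

/-- **`λ_n(x) = min { ∫ p² : deg p ≤ n, p(x) = 1 }`**: the minimum is attained, and it is a lower bound. -/
theorem christoffelFun_eq_min (n : ℕ) (x : ℝ) :
    (∀ p : ℝ[X], p.natDegree ≤ n → p.eval x = 1 → christoffelFun n x ≤ ∫ y in (-1 : ℝ)..1, p.eval y ^ 2)
      ∧ ∃ p : ℝ[X], p.natDegree ≤ n ∧ p.eval x = 1 ∧ ∫ y in (-1 : ℝ)..1, p.eval y ^ 2 = christoffelFun n x :=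
  ⟨fun _ hp hx => integral_sq_ge_of_eval_eq_one hp hx,
    ⟨C (kernel n x x)⁻¹ * kernelPoly n x, (extremal_eval n x).2, (extremal_eval n x).1, integral_sq_extremal n x⟩⟩

/-! ### The Gauss–Legendre weights as minima -/

/-- **`w_i = λ_n(x_i)`** at the nodes of the `(n+1)`-point rule (row 410). -/
theorem weight_eq_christoffelFun {n : ℕ} {s : Finset ℝ} (hcard : s.card = n + 1) (hs : ∀ r ∈ s, legP (n + 1) r = 0)
    {i : ℝ} (hi : i ∈ s) : weight s i = christoffelFun n i := by
  have h := weight_mul_kernel_self hcard hs hi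
  have hK := kernel_self_pos n i
  rw [christoffelFun, eq_div_iff hK.ne']
  exact h

/-- **`w_i ≤ ∫ p²` for every `p` of degree `≤ n` with `p(x_i) = 1`**, with equality for `p = K_n(·, x_i)/K_n(x_i, x_i)`:
the variational characterisation of the Gauss–Legendre weights. -/
theorem weight_le_integral_sq {n : ℕ} {s : Finset ℝ} (hcard : s.card = n + 1) (hs : ∀ r ∈ s, legP (n + 1) r = 0)
    {i : ℝ} (hi : i ∈ s) {p : ℝ[X]} (hp : p.natDegree ≤ n) (hpi : p.eval i = 1) :
    weight s i ≤ ∫ y in (-1 : ℝ)..1, p.eval y ^ 2 := by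
  rw [weight_eq_christoffelFun hcard hs hi]
  exact integral_sq_ge_of_eval_eq_one hp hpi

end Summit.Ventures.HodgeRepro2.T5SU11ChristoffelFunction
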